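import Literature.AnabelianGeometry.EtaleTheta.Discharge.Sec5Thm57AnchoredFamily
import Literature.AnabelianGeometry.EtaleTheta.Discharge.Sec5HfacOfPushforward
import Literature.AnabelianGeometry.EtaleTheta.Discharge.Sec3TemperedFrobenioidNotGroupLike
import Literature.AnabelianGeometry.EtaleTheta.Discharge.Sec5OfConstantsDictionary

/-!
# [EtTh] §5, Theorem 5.7 (anchored form): the abstract-`tf` binders (A) `hN`, `hgc₁`, `hfac₁`, `hinj` AT THE GENUINE §5 DATA over
# `B^temp(Π^tp_X)⁰` — discharged / re-keyed BY NAME onto the landed §3/§5 producers (pp. 303–304, 322, 330–331 / PDF pp. 77–78, 96, 104–105)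

Mochizuki, *The étale theta function and its Frobenioid-theoretic manifestations*, Publ. RIMS **45** (2009)
[cite: MochizukiEtTh2009, Thm 5.7 p.329–330 (PDF pp.103–104); Lem 5.8 p.331 (PDF p.105); Def 3.6 (ii)(iii) p.303 (PDF p.77);
§5 p.322 (PDF p.96)].  abc-iut cell, layer L2, seat abc-iut-w5-d123 (gen 5); abc-iut-L2-lead (gen 4) ROW **R335 «THM 5.7 (A)-BINDERS
AT THE GENUINE INSTANCE»**.  PROOF-ONLY knit (0 definitions, 0 new named facts; nothing landed is edited or restated) over
abc-iut-L2-d4's `Discharge/Sec5Thm57AnchoredFamily.lean` (p442166,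
`ThetaFrobenioidTower.thetaRootPreservedAll_ofConnectedTemperoidYddFamily_ofAnchored_ofPulledConstants`), whose residual list
(abc-iut-L2-d4 2026-08-26T11:50:03Z) opens with the five ABSTRACT-`tf` binders (A) = {`hnd`, `hN`, `hgc₁`, `hfac₁`, `hinj`}.

WHAT IS PROVED (generic connected base `B^temp(Π^tp_X)⁰`, any §2 tower `𝒯`, identification `ιX`, constants pulled back from an
object `X₀` receiving at most one arrow from every object — the exact context of p442166):
* `hN` — «some object of `C` is not group-like» — is a THEOREM for EVERY tempered Frobenioid (Def. 3.6 (ii)(b): `Φ(A) ≠ 0`;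
  abc-iut-w4-d008's `BiKummerSetting.exists_not_isGroupLikeObj`, `Sec3TemperedFrobenioidNotGroupLike.lean`):
  `hN_mkOfConnectedTemperoidYddTower`;
* `hinj` — injectivity of the pulled-back constants `B(t_N)^× ∘ c₀ : K'^× → O^×(B_N^birat)` at every level — ⟸ {`c₀` injective,
  the pull-backs `B(t_N) : B(X₀) → B(B_N^bs)` injective} (abc-iut-w4-d008's `TemperedFrobenioid.unitsMap_comp_injective`,
  `Sec5ConstEmbOfTerminal.lean`; the second input is NOT a field of the abstract Def. 3.6 (i) data — in print rational functions
  restrict injectively to coverings): `constEmb_pullback_injective`;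
* `hfac₁` — Lemma 5.8's factorisation «every `y ∈ Im(Π^tp_Y̲)` acts on `O^×(B_1)` through `s^⊓-gp_1` like some `h ∈ H_{B_1} =
  Im(Π^tp_Ÿ̲)`» at the FIRST ROOT of the tower — ⟸ {Prop. 3.4 (ii) `Prop34Cnst T₀ cnst`, the [FrdII] Ex. 1.3 (ii) identification
  `ecn : tf.base ⋙ cnst ≅ aug_* ⋙ G` of `D → D₀ → D^cnst` ("the natural functor `D₀ → D^cnst` determined by `Π^tp_X ↠ G_K`", §3
  p.298), `hYdd` («`aug(ιX Π^tp_Ÿ)` exhausts `aug(ιX Π^tp_X)`», `Ÿ` geometrically connected over `K = K̈`, §5 p.322)}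
  (abc-iut-w4-d008's `ThetaFrobenioid.hfac_ofConnectedTemperoidData_of_pushforward`, `Sec5HfacOfPushforward.lean`, read at the
  tower's level `1`, which IS `ofConnectedTemperoidData` over `𝒯.level 1` — abc-iut-L2-t4's `atLevel_ofConnectedTemperoidFamily_eq`,
  `rfl`): `hfac_atLevelOne_ofConnectedTemperoidYddFamily_of_pushforward`;
* **`thetaRootPreservedAll_ofConnectedTemperoidYddFamily_ofAnchored_ofPulledConstants_genuine`** — p442166's anchored capstone
  with `hN` GONE, `hinj` RE-KEYED to {`hc₀`, `ht`} and `hfac₁` RE-KEYED to {`hP34`, `cnst`, `G`, `ecn`, `hYdd`}; every other binder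
  verbatim (any universe);
* `hgc₁` — Lemma 5.8's geometric connectedness at the first root («a unit of `B_1` commuting with `s^⊓-gp_1(Im Π^tp_Y̲)` is a constant
  of `K`») — ⟸ abc-iut-L2-t11's ONE junction binder `ConstantsDictionary` for the level-`1` data read in `ℚ̄_p` against abc-iut-L2-t8's
  model `Cu.thetaEnvData μ₁ hC hS` of a §1 Setting + the identification `hY₁` of `Π^tp_Y̲` (`ConstantsDictionary.hgc` BY NAME, p439828;
  Galois descent `ℚ̄_p^{G_K} = K`) — for ANY tower of §5 data with morphisms in `Type`: `hgc_atLevelOne_of_constantsDictionary`; and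
  **`thetaRootPreservedAll_ofConnectedTemperoidYddFamily_ofAnchored_genuine_of_constantsDictionary`** — the capstone with ALL FOUR
  derivable binders of (A) gone / re-keyed (morphism universe `0`, as in every `ConstantsDictionary` consumer).
At the §1 Setting `(X, 𝒯, ιX) := (Π^tp_X̲̲, Cu.thetaEnvTower τ hC hS, id)` the Π-side inputs `hYdd`, `hY₁` are THEOREMS (abc-iut-L2-t4's
`hYdd_ofThetaSetting`, `identifiesPiY_ofThetaSettingData`): companion `Discharge/Sec5Thm57GenuineBindersAOfThetaSetting.lean`.
RESIDUAL of (A) reported, binder VERBATIM + why (abc-iut-L2-lead R335 «what does not discharge is reported as the exact residual»):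
* `hnd : IsNonDilatingOn tf.divisorMonoid` — DOES NOT DISCHARGE at the abstract `tf`: print ASSUMES it ([EtTh] Thm. 3.7 (ii) p.305
  "Suppose … that `Φ` is non-dilating"; Cor. 3.8 standing hypothesis), and the typed Def. 3.6 (ii) data admit a DILATING model
  (`TemperedFrobenioid.not_isNonDilatingOn_divisorMonoid`, `TemperedFrobenioidToyDilating.lean`), so no proof from the Def. 3.6 data
  exists; it holds for the geometric divisor monoid of Example 3.9, which is not in the tree.
NOT (A) and untouched: the junction data themselves (`ConstantsDictionary`, `Prop34Cnst`, `ecn`, `ht`) are the interface hypotheses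
of record of the lineage (no instance for an actual curve is constructed anywhere in the tree).
HONEST FRAMING: kernel-checked composition of landed theorems under named hypotheses for data so parametrised (the class
`TemperedFrobenioid T₀ (ConnectedPart (BTemp X.Pi)) VD` is not shown inhabited for an actual curve); nothing asserts any result of
[EtTh] unconditionally; typed ≠ discharged; no side taken on anything downstream ([IUTchIII] Cor. 3.12 in particular). -/

noncomputable section

namespace Literature.AnabelianGeometry.EtaleTheta

open CategoryTheory Opposite Literature.AlgebraicGeometry.Frobenioids Literature.AnabelianGeometry.SemiGraphs
  Literature.AnabelianGeometry.SemiGraphs.GaloisObjects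

universe u₀ v₀ w u₁ v₁

namespace ThetaFrobenioidTower

section Genuine

variable {K : Type u₀} [Field K] {X : SemiGraphs.TemperedArithmeticGroup.{u₀} K} {D₀ : Type u₀} [Category.{v₀} D₀]
  {V : FrdIMonoidStub.{w}} {T₀ : RealifiedDivisorMonoids (D₀ := D₀) V}
  {VD : FrdICatStub.{u₀ + 1, u₀, w} (ConnectedPart (BTemp X.Pi))}
  {tf : TemperedFrobenioid T₀ (ConnectedPart (BTemp X.Pi)) VD} {hZ : tf.monoidType = MonoidType.Z}
  {hP : ∀ A : (ConnectedPart (BTemp X.Pi))ᵒᵖ, IsPerfect (tf.Φ.carrier A)}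
  {NH : Subgroup (Field.absoluteGaloisGroup K) → tf.category → ℕ+ → Prop}
  {E : Set ℕ+} (𝒯 : ThetaEnvTower.{max u₀ w} E) (ιX : 𝒯.PiX ≃ₜ* X.Pi)
  {pullFrac : ∀ {A A' : (BiKummerSetting.mkOfConnectedTemperoidYddTower X tf hZ hP NH 𝒯 ιX).C} (_ : A' ⟶ A),
    (BiKummerSetting.mkOfConnectedTemperoidYddTower X tf hZ hP NH 𝒯 ιX).biratUnits A →
      (BiKummerSetting.mkOfConnectedTemperoidYddTower X tf hZ hP NH 𝒯 ιX).biratUnits A'}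
  {lv : ℕ+}
  {θ : (BiKummerSetting.mkOfConnectedTemperoidYddTower X tf hZ hP NH 𝒯 ιX).biratUnits
    (BiKummerSetting.mkOfConnectedTemperoidYddTower X tf hZ hP NH 𝒯 ιX).Aodot}
  {Bl : (BiKummerSetting.mkOfConnectedTemperoidYddTower X tf hZ hP NH 𝒯 ιX).C}
  {Pl : (BiKummerSetting.mkOfConnectedTemperoidYddTower X tf hZ hP NH 𝒯 ιX).FractionPair θ Bl}
  {Rl : (BiKummerSetting.mkOfConnectedTemperoidYddTower X tf hZ hP NH 𝒯 ιX).NthRoot θ Pl lv pullFrac}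
  (h : ModelFrobenioid.Hypotheses tf.divisorMonoid tf.ratFnFunctor)
  (Q : FrobenioidTheta.ThetaSubquotientStub.{w} (ConnectedPart (BTemp X.Pi))) (odd_l : Odd (lv : ℕ))
  (R : ∀ N : ℕ+, (BiKummerSetting.mkOfConnectedTemperoidYddTower X tf hZ hP NH 𝒯 ιX).NthRoot Rl.root Rl.pair N pullFrac)
  (K' : Type w) [Field K'] {X₀ : ConnectedPart (BTemp X.Pi)}
  (hX₀ : ∀ Y : ConnectedPart (BTemp X.Pi), Subsingleton (Y ⟶ X₀)) (t : ∀ N : ℕ+, (R N).BN.base ⟶ X₀)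
  (c₀ : K'ˣ →* (tf.ratFnFunctor.obj (op X₀))ˣ)
  -- `hinj` RE-KEYED: `c₀` injective and the pull-backs `B(t_N)` injective (abc-iut-w4-d008's `unitsMap_comp_injective`)
  (hc₀ : Function.Injective c₀) (ht : ∀ N : ℕ+, Function.Injective (tf.ratFnFunctor.map (t N).op).hom)
  (hinvc : ∀ (N : ℕ+) (g : Aut (R N).AN.base),
    pull tf.divisorMonoid g.hom (ModelFrobenioid.div (R N).pair.num) = ModelFrobenioid.div (R N).pair.num)
  (hinvp : ∀ (N : ℕ+) (y : 𝒯.PiX), y ∈ 𝒯.PiYdd →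
    pull tf.divisorMonoid ((BiKummerSetting.mkOfConnectedTemperoidYddTower X tf hZ hP NH 𝒯 ιX).galoisSurj (R N).AN.base
      (R N).αData.isGalois (ιX y)).hom (ModelFrobenioid.div (R N).pair.den) = ModelFrobenioid.div (R N).pair.den)
  (α : ∀ {N N' : ℕ+}, (N : ℕ) ∣ N' → ((R N').AN ⟶ (R N).AN))
  (β : ∀ {N N' : ℕ+}, (N : ℕ) ∣ N' → ((R N').BN ⟶ (R N).BN))
  (comm_sCap : ∀ {N N' : ℕ+} (hd : (N : ℕ) ∣ N'), (R N').pair.num ≫ β hd = α hd ≫ (R N).pair.num)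
  (comm_sCup : ∀ {N N' : ℕ+} (hd : (N : ℕ) ∣ N'), (R N').pair.den ≫ β hd = α hd ≫ (R N).pair.den)
  (isIsometry_α : ∀ {N N' : ℕ+} (hd : (N : ℕ) ∣ N'),
    ((BiKummerSetting.mkOfConnectedTemperoidYddTower X tf hZ hP NH 𝒯 ιX).sec5Stub h).pre.IsIsometry (α hd))
  (degFr_α : ∀ {N N' : ℕ+} (hd : (N : ℕ) ∣ N'),
    (((BiKummerSetting.mkOfConnectedTemperoidYddTower X tf hZ hP NH 𝒯 ιX).sec5Stub h).pre.degFr (α hd) : ℕ) * N = N')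
  (isIsometry_β : ∀ {N N' : ℕ+} (hd : (N : ℕ) ∣ N'),
    ((BiKummerSetting.mkOfConnectedTemperoidYddTower X tf hZ hP NH 𝒯 ιX).sec5Stub h).pre.IsIsometry (β hd))
  (degFr_β : ∀ {N N' : ℕ+} (hd : (N : ℕ) ∣ N'),
    (((BiKummerSetting.mkOfConnectedTemperoidYddTower X tf hZ hP NH 𝒯 ιX).sec5Stub h).pre.degFr (β hd) : ℕ) * N = N')
  (baseFrob_α : ∀ {N N' : ℕ+} (hd : (N : ℕ) ∣ N'),
    (BiKummerSetting.mkOfConnectedTemperoidYddTower X tf hZ hP NH 𝒯 ιX).IsOfBaseFrobeniusType (α hd))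

/-- **Binder `hN` of (A) is a THEOREM for every tempered Frobenioid** — here at the §5 setting with `A_⊙^bs := Ÿ` over
`B^temp(Π^tp_X)⁰`, in the exact shape of p442166: some object of `C` is not group-like (Def. 3.6 (ii)(b) ⇒ `Φ(A) ≠ 0` for every
`A`; abc-iut-w4-d008's `BiKummerSetting.exists_not_isGroupLikeObj` BY NAME).  [cite: MochizukiEtTh2009, Def 3.6 (ii) p.303 (PDF p.77)] -/
theorem hN_mkOfConnectedTemperoidYddTower :
    ∃ A : (BiKummerSetting.mkOfConnectedTemperoidYddTower X tf hZ hP NH 𝒯 ιX).C,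
      ¬ (PreFrobenioidData.ofModel tf.divisorMonoid tf.ratFnFunctor tf.divBNatTrans).IsGroupLikeObj A :=
  (BiKummerSetting.mkOfConnectedTemperoidYddTower X tf hZ hP NH 𝒯 ιX).exists_not_isGroupLikeObj

include hc₀ ht in
/-- **Binder `hinj` of (A) RE-KEYED**: the constants pulled back from `X₀`, `B(t_N)^× ∘ c₀ : K'^× → O^×(B_N^birat)`, are injective at
every level as soon as `c₀` is injective and the pull-backs `B(t_N)` are (abc-iut-w4-d008's `TemperedFrobenioid.unitsMap_comp_injective`
BY NAME; Lemma 5.8 "the natural inclusion `K^× ↪ O^×(B_N^birat)`").  [cite: MochizukiEtTh2009, Lem 5.8 p.331 (PDF p.105)] -/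
theorem constEmb_pullback_injective (N : ℕ+) :
    Function.Injective ((Units.map (tf.ratFnFunctor.map (t N).op).hom).comp c₀) :=
  tf.unitsMap_comp_injective (t N) hc₀ (ht N)

include h in
/-- **Binder `hfac₁` of (A) at the FIRST ROOT of the genuine connected tower from Prop. 3.4 (ii), the [FrdII] Ex. 1.3 (ii)
identification of `D → D^cnst`, and `hYdd`** — in the TOWER currency of p442166 (`T.atLevel 1`, `T.BN 1`, `T.sgpCap 1`): every
`y ∈ Im(Π^tp_Y̲)` acts on `O^×(B_1)` through `s^⊓-gp_1` like some `h ∈ H_{B_1} = Im(Π^tp_Ÿ̲)` (Lemma 5.8 proof p.331 "`Π^tp_Y` [i.e.,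
`G_K` …] acts").  abc-iut-w4-d008's `ThetaFrobenioid.hfac_ofConnectedTemperoidData_of_pushforward` BY NAME at the tower's level `1`,
which IS `ofConnectedTemperoidData` over `𝒯.level 1` (abc-iut-L2-t4's `atLevel_ofConnectedTemperoidFamily_eq`, definitionally).
[cite: MochizukiEtTh2009, Lem 5.8 p.331 (PDF p.105); §3 p.298 (PDF p.72); §5 p.322 (PDF p.96)] -/
theorem hfac_atLevelOne_ofConnectedTemperoidYddFamily_of_pushforward
    (T : ThetaFrobenioidTower.{w} (BiKummerSetting.mkOfConnectedTemperoidYddTower X tf hZ hP NH 𝒯 ιX).C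
      (ConnectedPart (BTemp X.Pi)))
    (hT : T = ofConnectedTemperoidFamily h Q odd_l R ιX K' (fun N => (Units.map (tf.ratFnFunctor.map (t N).op).hom).comp c₀)
      (fun N => tf.unitsMap_comp_injective (t N) hc₀ (ht N)) hinvc hinvp α β comm_sCap comm_sCup isIsometry_α degFr_α
      isIsometry_β degFr_β baseFrob_α)
    {Dcnst : Type u₁} [Category.{v₁} Dcnst] (cnst : D₀ ⥤ Dcnst) (G : ConnectedPart (BTemp (Field.absoluteGaloisGroup K)) ⥤ Dcnst)
    (ecn : tf.base ⋙ cnst ≅ QuasiTemperoid.pushforward X.aug.toMonoidHom X.aug_surjective X.augIsOpenMap_holds ⋙ G)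
    (hP34 : RealifiedDivisorMonoids.Prop34Cnst T₀ cnst)
    (hYdd : ∀ y : 𝒯.PiX, ∃ k ∈ 𝒯.PiYdd, X.aug (ιX k) = X.aug (ιX y)) :
    ∀ y ∈ (T.atLevel 1).imPiY, ∃ x ∈ (T.atLevel 1).HB, ∀ u ∈ (T.atLevel 1).units (T.BN 1),
      T.sgpCap 1 y * u * (T.sgpCap 1 y)⁻¹ = T.sgpCap 1 x * u * (T.sgpCap 1 x)⁻¹ := by
  subst hT
  exact ThetaFrobenioid.hfac_ofConnectedTemperoidData_of_pushforward (T := 𝒯.level ⟨1, 𝒯.one_mem⟩) h Q odd_l (R 1) ιX K'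
    ((Units.map (tf.ratFnFunctor.map (t 1).op).hom).comp c₀) (tf.unitsMap_comp_injective (t 1) hc₀ (ht 1)) (hinvc 1)
    (hinvp 1) cnst G ecn hP34 hYdd

include hX₀ h hc₀ ht in
/-- **[EtTh] Theorem 5.7 (root level) at ALL levels for the genuine connected tower with pulled-back constants, ANCHORED form — the
abstract-`tf` binders (A) `hN`, `hfac₁`, `hinj` of abc-iut-L2-d4's `…_ofAnchored_ofPulledConstants` (p442166) DISCHARGED / RE-KEYED onto
the landed producers**: `hN` is GONE (Def. 3.6 (ii)(b), `BiKummerSetting.exists_not_isGroupLikeObj`); `hinj` ⟸ {`hc₀` : `c₀` injective,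
`ht` : the pull-backs `B(t_N)` injective} (`TemperedFrobenioid.unitsMap_comp_injective`); `hfac₁` ⟸ {`hP34` : Prop. 3.4 (ii)
`Prop34Cnst T₀ cnst`, `ecn : tf.base ⋙ cnst ≅ aug_* ⋙ G` ([FrdII] Ex. 1.3 (ii), §3 p.298), `hYdd` (§5 p.322)}
(`ThetaFrobenioid.hfac_ofConnectedTemperoidData_of_pushforward`).  Every other binder of p442166 VERBATIM: (A) `hnd` (print's standing
hypothesis "`Φ` non-dilating", Thm. 3.7 (ii); NOT derivable from Def. 3.6 — `TemperedFrobenioid.not_isNonDilatingOn_divisorMonoid`),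
`hgc₁` (Lemma 5.8's geometric connectedness; discharged from the ONE `ConstantsDictionary` binder at the §1 Setting in the companion);
the seeds `αs`, `βs` with `hdivcap₁`/`hdivcup₁` (Prop. 5.3 (vi) at `A_1`, `e = 1` form) and `hP24` (Prop. 2.4, ∀γ); the coherent family
`hfam` (Rmk. 4.3.2 / Prop. 4.2 (iv)); (C) `hc` (Cor. 2.8 (i) on the Prop. 5.2 (iii) classes).
[cite: MochizukiEtTh2009, Thm 5.7 p.329–330 (PDF pp.103–104); Lem 5.8 p.331 (PDF p.105); Def 3.6 (ii)(iii) p.303 (PDF p.77); §5 p.322 (PDF p.96)] -/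
theorem thetaRootPreservedAll_ofConnectedTemperoidYddFamily_ofAnchored_ofPulledConstants_genuine
    (T : ThetaFrobenioidTower.{w} (BiKummerSetting.mkOfConnectedTemperoidYddTower X tf hZ hP NH 𝒯 ιX).C
      (ConnectedPart (BTemp X.Pi)))
    (hT : T = ofConnectedTemperoidFamily h Q odd_l R ιX K' (fun N => (Units.map (tf.ratFnFunctor.map (t N).op).hom).comp c₀)
      (fun N => tf.unitsMap_comp_injective (t N) hc₀ (ht N)) hinvc hinvp α β comm_sCap comm_sCup isIsometry_α degFr_α
      isIsometry_β degFr_β baseFrob_α)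
    -- (A), residual: print's standing hypothesis "`Φ` non-dilating" (Thm. 3.7 (ii) / Cor. 3.8)
    (hnd : IsNonDilatingOn tf.divisorMonoid)
    -- (A), residual here (discharged at the §1 Setting from the ONE `ConstantsDictionary` binder): Lemma 5.8 at the first root
    (hgc₁ : ∀ u : (T.atLevel 1).units (T.BN 1),
      (∀ y ∈ (T.atLevel 1).imPiY, T.sgpCap 1 y * (u : Aut (T.BN 1)) * (T.sgpCap 1 y)⁻¹ = u) →
        (T.atLevel 1).unitsToBirat (T.BN 1) u ∈ (T.constEmb 1).range)
    (Ψ : (BiKummerSetting.mkOfConnectedTemperoidYddTower X tf hZ hP NH 𝒯 ιX).C ≌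
      (BiKummerSetting.mkOfConnectedTemperoidYddTower X tf hZ hP NH 𝒯 ιX).C)
    -- (A) `hfac₁` RE-KEYED: Prop. 3.4 (ii), the identification `D → D₀ → D^cnst ≅ aug_* ⋙ G`, and `hYdd`
    {Dcnst : Type u₁} [Category.{v₁} Dcnst] (cnst : D₀ ⥤ Dcnst) (G : ConnectedPart (BTemp (Field.absoluteGaloisGroup K)) ⥤ Dcnst)
    (ecn : tf.base ⋙ cnst ≅ QuasiTemperoid.pushforward X.aug.toMonoidHom X.aug_surjective X.augIsOpenMap_holds ⋙ G)
    (hP34 : RealifiedDivisorMonoids.Prop34Cnst T₀ cnst)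
    (hYdd : ∀ y : 𝒯.PiX, ∃ k ∈ 𝒯.PiYdd, X.aug (ιX k) = X.aug (ιX y))
    -- the seeds of the anchor at the first root [Thm. 5.10 (i)] and the inputs of abc-iut-w5-d245's producer
    (αs : Ψ.functor.obj (T.AN 1) ≅ T.AN 1) (βs : Ψ.functor.obj (T.BN 1) ≅ T.BN 1)
    (hdivcap₁ : T.pre.div (αs.inv ≫ Ψ.functor.map (T.sCap 1) ≫ βs.hom) = T.pre.div (T.sCap 1))
    (hdivcup₁ : T.pre.div (αs.inv ≫ Ψ.functor.map (T.sCup 1) ≫ βs.hom) = T.pre.div (T.sCup 1))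
    (hP24 : ∀ γ : 𝒯.PiX ≃ₜ* 𝒯.PiX, 𝒯.PiYdd.map γ.toMulEquiv.toMonoidHom = 𝒯.PiYdd)
    -- the coherent family, for every normalised anchor (abc-iut-f-121's p438241 output shape)
    (hfam : ∀ (α₁ : Ψ.functor.obj (T.AN 1) ≅ T.AN 1) (β₁ : Ψ.functor.obj (T.BN 1) ≅ T.BN 1) (u₁ : Aut (T.BN 1)),
      u₁ ∈ (T.atLevel 1).units (T.BN 1) →
      α₁.inv ≫ Ψ.functor.map (T.sCap 1) ≫ β₁.hom = T.sCap 1 →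
      α₁.inv ≫ Ψ.functor.map (T.sCup 1) ≫ β₁.hom = T.sCup 1 ≫ u₁.hom →
        ∀ N : ℕ+, ∃ (a : Ψ.functor.obj (T.AN N) ≅ T.AN N) (b : Ψ.functor.obj (T.BN N) ≅ T.BN N) (w : Aut (T.BN N)),
          w ∈ (T.atLevel N).units (T.BN N) ∧
          a.inv ≫ Ψ.functor.map (T.sCap N) ≫ b.hom = T.sCap N ∧
          a.inv ≫ Ψ.functor.map (T.sCup N) ≫ b.hom = T.sCup N ≫ w.hom ∧
          a.inv ≫ Ψ.functor.map (T.α (one_dvd_level N)) ≫ α₁.hom = T.α (one_dvd_level N) ∧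
          b.inv ≫ Ψ.functor.map (T.β (one_dvd_level N)) ≫ β₁.hom = T.β (one_dvd_level N))
    -- (C): the level-1 discrepancy constant of every normalised transport is a `2l`-th root of unity
    (hc : ∀ (α₁ : Ψ.functor.obj (T.AN 1) ≅ T.AN 1) (β₁ : Ψ.functor.obj (T.BN 1) ≅ T.BN 1) (u₁ : Aut (T.BN 1))
      (hu₁ : u₁ ∈ (T.atLevel 1).units (T.BN 1)),
      α₁.inv ≫ Ψ.functor.map (T.sCap 1) ≫ β₁.hom = T.sCap 1 →
      α₁.inv ≫ Ψ.functor.map (T.sCup 1) ≫ β₁.hom = T.sCup 1 ≫ u₁.hom →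
        ∀ c : T.Kˣ, (T.atLevel 1).unitsToBirat (T.BN 1) ⟨u₁, hu₁⟩ = T.constEmb 1 c → c ^ (2 * T.l) = 1) :
    T.ThetaRootPreservedAll Ψ :=
  thetaRootPreservedAll_ofConnectedTemperoidYddFamily_ofAnchored_ofPulledConstants (𝒯 := 𝒯) (ιX := ιX) (h := h) (Q := Q)
    (odd_l := odd_l) (R := R) (K' := K') (hX₀ := hX₀) (t := t) (c₀ := c₀)
    (hinj := fun N => tf.unitsMap_comp_injective (t N) hc₀ (ht N)) (hinvc := hinvc) (hinvp := hinvp) (α := α) (β := β)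
    (comm_sCap := comm_sCap) (comm_sCup := comm_sCup) (isIsometry_α := isIsometry_α) (degFr_α := degFr_α)
    (isIsometry_β := isIsometry_β) (degFr_β := degFr_β) (baseFrob_α := baseFrob_α) (T := T) (hT := hT) (hnd := hnd)
    (hN := hN_mkOfConnectedTemperoidYddTower 𝒯 ιX) (hgc₁ := hgc₁) (Ψ := Ψ)
    (hfac₁ := hfac_atLevelOne_ofConnectedTemperoidYddFamily_of_pushforward 𝒯 ιX h Q odd_l R K' t c₀ hc₀ ht hinvc hinvp α β
      comm_sCap comm_sCup isIsometry_α degFr_α isIsometry_β degFr_β baseFrob_α T hT cnst G ecn hP34 hYdd)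
    (αs := αs) (βs := βs) (hdivcap₁ := hdivcap₁) (hdivcup₁ := hdivcup₁) (hP24 := hP24) (hfam := hfam) (hc := hc)

end Genuine

/-! ## `hgc₁` from the ONE junction binder «constants of `B_1` read in `ℚ̄_p`» (abc-iut-L2-t11's `ConstantsDictionary`)

The dictionary reads the constants in `ℚ̄_p`, so the morphism universe of `C` is `0` (as in every `ConstantsDictionary` consumer);
the base `B^temp(Π^tp_X)⁰`, the §2 tower `𝒯` and the identification `ιX` stay GENERIC — the §1 Setting enters only through the
comparison data `(Cu, μ₁, hC, hS, ι₁, m₁)` of the dictionary and the identification `hY₁` of `Π^tp_Y̲` (a THEOREM at the Setting: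
abc-iut-L2-t4's `identifiesPiY_ofThetaSettingData`, see `identifiesPiY_atLevelOne_ofThetaSettingYddFamily` below). -/

section Dictionary

variable {K : Type} [Field K] {X : SemiGraphs.TemperedArithmeticGroup.{0} K} {D₀ : Type} [Category.{v₀} D₀]
  {V : FrdIMonoidStub.{0}} {T₀ : RealifiedDivisorMonoids (D₀ := D₀) V}
  {VD : FrdICatStub.{1, 0, 0} (ConnectedPart (BTemp X.Pi))}
  {tf : TemperedFrobenioid T₀ (ConnectedPart (BTemp X.Pi)) VD} {hZ : tf.monoidType = MonoidType.Z}
  {hP : ∀ A : (ConnectedPart (BTemp X.Pi))ᵒᵖ, IsPerfect (tf.Φ.carrier A)}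
  {NH : Subgroup (Field.absoluteGaloisGroup K) → tf.category → ℕ+ → Prop}
  {E : Set ℕ+} (𝒯 : ThetaEnvTower.{0} E) (ιX : 𝒯.PiX ≃ₜ* X.Pi)
  {pullFrac : ∀ {A A' : (BiKummerSetting.mkOfConnectedTemperoidYddTower X tf hZ hP NH 𝒯 ιX).C} (_ : A' ⟶ A),
    (BiKummerSetting.mkOfConnectedTemperoidYddTower X tf hZ hP NH 𝒯 ιX).biratUnits A →
      (BiKummerSetting.mkOfConnectedTemperoidYddTower X tf hZ hP NH 𝒯 ιX).biratUnits A'}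
  {lv : ℕ+}
  {θ : (BiKummerSetting.mkOfConnectedTemperoidYddTower X tf hZ hP NH 𝒯 ιX).biratUnits
    (BiKummerSetting.mkOfConnectedTemperoidYddTower X tf hZ hP NH 𝒯 ιX).Aodot}
  {Bl : (BiKummerSetting.mkOfConnectedTemperoidYddTower X tf hZ hP NH 𝒯 ιX).C}
  {Pl : (BiKummerSetting.mkOfConnectedTemperoidYddTower X tf hZ hP NH 𝒯 ιX).FractionPair θ Bl}
  {Rl : (BiKummerSetting.mkOfConnectedTemperoidYddTower X tf hZ hP NH 𝒯 ιX).NthRoot θ Pl lv pullFrac}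
  (h : ModelFrobenioid.Hypotheses tf.divisorMonoid tf.ratFnFunctor)
  (Q : FrobenioidTheta.ThetaSubquotientStub.{0} (ConnectedPart (BTemp X.Pi))) (odd_l : Odd (lv : ℕ))
  (R : ∀ N : ℕ+, (BiKummerSetting.mkOfConnectedTemperoidYddTower X tf hZ hP NH 𝒯 ιX).NthRoot Rl.root Rl.pair N pullFrac)
  (K' : Type) [Field K'] {X₀ : ConnectedPart (BTemp X.Pi)}
  (hX₀ : ∀ Y : ConnectedPart (BTemp X.Pi), Subsingleton (Y ⟶ X₀)) (t : ∀ N : ℕ+, (R N).BN.base ⟶ X₀)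
  (c₀ : K'ˣ →* (tf.ratFnFunctor.obj (op X₀))ˣ)
  (hc₀ : Function.Injective c₀) (ht : ∀ N : ℕ+, Function.Injective (tf.ratFnFunctor.map (t N).op).hom)
  (hinvc : ∀ (N : ℕ+) (g : Aut (R N).AN.base),
    pull tf.divisorMonoid g.hom (ModelFrobenioid.div (R N).pair.num) = ModelFrobenioid.div (R N).pair.num)
  (hinvp : ∀ (N : ℕ+) (y : 𝒯.PiX), y ∈ 𝒯.PiYdd →
    pull tf.divisorMonoid ((BiKummerSetting.mkOfConnectedTemperoidYddTower X tf hZ hP NH 𝒯 ιX).galoisSurj (R N).AN.base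
      (R N).αData.isGalois (ιX y)).hom (ModelFrobenioid.div (R N).pair.den) = ModelFrobenioid.div (R N).pair.den)
  (α : ∀ {N N' : ℕ+}, (N : ℕ) ∣ N' → ((R N').AN ⟶ (R N).AN))
  (β : ∀ {N N' : ℕ+}, (N : ℕ) ∣ N' → ((R N').BN ⟶ (R N).BN))
  (comm_sCap : ∀ {N N' : ℕ+} (hd : (N : ℕ) ∣ N'), (R N').pair.num ≫ β hd = α hd ≫ (R N).pair.num)
  (comm_sCup : ∀ {N N' : ℕ+} (hd : (N : ℕ) ∣ N'), (R N').pair.den ≫ β hd = α hd ≫ (R N).pair.den)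
  (isIsometry_α : ∀ {N N' : ℕ+} (hd : (N : ℕ) ∣ N'),
    ((BiKummerSetting.mkOfConnectedTemperoidYddTower X tf hZ hP NH 𝒯 ιX).sec5Stub h).pre.IsIsometry (α hd))
  (degFr_α : ∀ {N N' : ℕ+} (hd : (N : ℕ) ∣ N'),
    (((BiKummerSetting.mkOfConnectedTemperoidYddTower X tf hZ hP NH 𝒯 ιX).sec5Stub h).pre.degFr (α hd) : ℕ) * N = N')
  (isIsometry_β : ∀ {N N' : ℕ+} (hd : (N : ℕ) ∣ N'),
    ((BiKummerSetting.mkOfConnectedTemperoidYddTower X tf hZ hP NH 𝒯 ιX).sec5Stub h).pre.IsIsometry (β hd))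
  (degFr_β : ∀ {N N' : ℕ+} (hd : (N : ℕ) ∣ N'),
    (((BiKummerSetting.mkOfConnectedTemperoidYddTower X tf hZ hP NH 𝒯 ιX).sec5Stub h).pre.degFr (β hd) : ℕ) * N = N')
  (baseFrob_α : ∀ {N N' : ℕ+} (hd : (N : ℕ) ∣ N'),
    (BiKummerSetting.mkOfConnectedTemperoidYddTower X tf hZ hP NH 𝒯 ιX).IsOfBaseFrobeniusType (α hd))
  -- the §1 Setting against which the constants of `B_1` are read (abc-iut-L2-t8's model `Cu.thetaEnvData μ₁ hC hS`)
  {p : ℕ} [Fact p.Prime] {DS : ThetaSetting p} {ES : DS.EtaleThetaData} {l' : ℕ} (Cu : ES.DoubleUnderline l')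
  (hC : DS.Compat) (hS : DS.Sec2Hyps)

/-- **Binder `hgc₁` of (A) from the ONE junction binder**, for ANY tower `T` of §5 data (in particular the genuine connected tower):
«a unit of `B_1` commuting with `s^⊓-gp_1(Im Π^tp_Y̲)` is a constant of `K`» (Lemma 5.8: `(O_K^×)^{1/N} = (K^×)^{1/N} ∩ O^×(B_N)`,
"`Π^tp_Y` [i.e., `G_K` …] acts", "geometrically connected over `K`") — in the TOWER currency of p442166 — follows from
abc-iut-L2-t11's `ConstantsDictionary` for the level-`1` data `T.atLevel 1` read against `Cu.thetaEnvData μ₁ hC hS` along `ι₁`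
(`ConstantsDictionary.hgc` BY NAME, p439828; Galois descent `ℚ̄_p^{G_K} = K`) and the identification `hY₁` of `Π^tp_Y̲`.
[cite: MochizukiEtTh2009, Lem 5.8 p.331 (PDF p.105); Def 3.6 (iv) p.304 (PDF p.78)] -/
theorem hgc_atLevelOne_of_constantsDictionary {C₀ : Type u₁} [Category.{0} C₀] {D₁ : Type v₁} [Category.{v₀} D₁]
    (T : ThetaFrobenioidTower.{0} C₀ D₁)
    {μ₁ : DS.CyclotomeMod l' (T.atLevel 1).N} {ι₁ : (T.atLevel 1).PiX ≃ₜ* (Cu.thetaEnvData μ₁ hC hS).PiX}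
    {m₁ : (T.atLevel 1).muTorsion (T.atLevel 1).BN (T.atLevel 1).N ≃* (Cu.thetaEnvData μ₁ hC hS).mu}
    (α₁ : (T.atLevel 1).BiratAutAction) {Cst₁ : Subgroup ((T.atLevel 1).biratUnits (T.atLevel 1).BN)}
    {ν₁ : Cst₁ →* (PadicAlgCl p)ˣ}
    (hD₁ : ThetaFrobenioid.BiratAutAction.ConstantsDictionary α₁ Cu μ₁ hC hS ι₁ m₁ Cst₁ ν₁)
    (hY₁ : (T.atLevel 1).IdentifiesPiY (Cu.thetaEnvData μ₁ hC hS) ι₁.toMulEquiv) :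
    ∀ u : (T.atLevel 1).units (T.BN 1),
      (∀ y ∈ (T.atLevel 1).imPiY, T.sgpCap 1 y * (u : Aut (T.BN 1)) * (T.sgpCap 1 y)⁻¹ = u) →
        (T.atLevel 1).unitsToBirat (T.BN 1) u ∈ (T.constEmb 1).range :=
  hD₁.hgc hY₁

include hX₀ h hc₀ ht in
/-- **[EtTh] Theorem 5.7 (root level) at ALL levels for the genuine connected tower with pulled-back constants, ANCHORED form, with
ALL FOUR DERIVABLE binders of (A) discharged / re-keyed onto the landed producers** — `hN` GONE (Def. 3.6 (ii)(b)); `hinj` ⟸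
{`hc₀`, `ht`}; `hfac₁` ⟸ {`hP34`, `ecn`, `hYdd`} (Prop. 3.4 (ii), [FrdII] Ex. 1.3 (ii), §5 p.322); **`hgc₁` ⟸ the ONE junction binder
`hD₁ : ConstantsDictionary` at the first root + `hY₁`** (Lemma 5.8 by Galois descent, abc-iut-L2-t11 `ConstantsDictionary.hgc`).
RESIDUAL of (A): `hnd` ALONE (print's standing hypothesis "`Φ` non-dilating", Thm. 3.7 (ii) p.305 / Cor. 3.8; refuted for the bare
Def. 3.6 (ii) data by `TemperedFrobenioid.not_isNonDilatingOn_divisorMonoid`).  The other binders of p442166 VERBATIM: seeds `αs`, `βs`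
with `hdivcap₁`/`hdivcup₁` (Prop. 5.3 (vi)) and `hP24` (Prop. 2.4); the coherent family `hfam` (Rmk. 4.3.2 / Prop. 4.2 (iv)); (C) `hc`
(Cor. 2.8 (i) on the Prop. 5.2 (iii) classes).
[cite: MochizukiEtTh2009, Thm 5.7 p.329–330 (PDF pp.103–104); Lem 5.8 p.331 (PDF p.105); Def 3.6 (ii)(iii)(iv) p.303–304 (PDF pp.77–78); §5 p.322 (PDF p.96)] -/
theorem thetaRootPreservedAll_ofConnectedTemperoidYddFamily_ofAnchored_genuine_of_constantsDictionary
    (T : ThetaFrobenioidTower.{0} (BiKummerSetting.mkOfConnectedTemperoidYddTower X tf hZ hP NH 𝒯 ιX).C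
      (ConnectedPart (BTemp X.Pi)))
    (hT : T = ofConnectedTemperoidFamily h Q odd_l R ιX K' (fun N => (Units.map (tf.ratFnFunctor.map (t N).op).hom).comp c₀)
      (fun N => tf.unitsMap_comp_injective (t N) hc₀ (ht N)) hinvc hinvp α β comm_sCap comm_sCup isIsometry_α degFr_α
      isIsometry_β degFr_β baseFrob_α)
    -- (A), residual: print's standing hypothesis "`Φ` non-dilating" (Thm. 3.7 (ii) / Cor. 3.8)
    (hnd : IsNonDilatingOn tf.divisorMonoid)
    -- (A) `hgc₁` RE-KEYED: the ONE junction binder at the first root and the identification of `Π^tp_Y̲`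
    {μ₁ : DS.CyclotomeMod l' (T.atLevel 1).N} {ι₁ : (T.atLevel 1).PiX ≃ₜ* (Cu.thetaEnvData μ₁ hC hS).PiX}
    {m₁ : (T.atLevel 1).muTorsion (T.atLevel 1).BN (T.atLevel 1).N ≃* (Cu.thetaEnvData μ₁ hC hS).mu}
    (α₁ : (T.atLevel 1).BiratAutAction) {Cst₁ : Subgroup ((T.atLevel 1).biratUnits (T.atLevel 1).BN)}
    {ν₁ : Cst₁ →* (PadicAlgCl p)ˣ}
    (hD₁ : ThetaFrobenioid.BiratAutAction.ConstantsDictionary α₁ Cu μ₁ hC hS ι₁ m₁ Cst₁ ν₁)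
    (hY₁ : (T.atLevel 1).IdentifiesPiY (Cu.thetaEnvData μ₁ hC hS) ι₁.toMulEquiv)
    (Ψ : (BiKummerSetting.mkOfConnectedTemperoidYddTower X tf hZ hP NH 𝒯 ιX).C ≌
      (BiKummerSetting.mkOfConnectedTemperoidYddTower X tf hZ hP NH 𝒯 ιX).C)
    -- (A) `hfac₁` RE-KEYED: Prop. 3.4 (ii), the identification `D → D₀ → D^cnst ≅ aug_* ⋙ G`, and `hYdd`
    {Dcnst : Type u₁} [Category.{v₁} Dcnst] (cnst : D₀ ⥤ Dcnst) (G : ConnectedPart (BTemp (Field.absoluteGaloisGroup K)) ⥤ Dcnst)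
    (ecn : tf.base ⋙ cnst ≅ QuasiTemperoid.pushforward X.aug.toMonoidHom X.aug_surjective X.augIsOpenMap_holds ⋙ G)
    (hP34 : RealifiedDivisorMonoids.Prop34Cnst T₀ cnst)
    (hYdd : ∀ y : 𝒯.PiX, ∃ k ∈ 𝒯.PiYdd, X.aug (ιX k) = X.aug (ιX y))
    -- the seeds of the anchor at the first root [Thm. 5.10 (i)] and the inputs of abc-iut-w5-d245's producer
    (αs : Ψ.functor.obj (T.AN 1) ≅ T.AN 1) (βs : Ψ.functor.obj (T.BN 1) ≅ T.BN 1)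
    (hdivcap₁ : T.pre.div (αs.inv ≫ Ψ.functor.map (T.sCap 1) ≫ βs.hom) = T.pre.div (T.sCap 1))
    (hdivcup₁ : T.pre.div (αs.inv ≫ Ψ.functor.map (T.sCup 1) ≫ βs.hom) = T.pre.div (T.sCup 1))
    (hP24 : ∀ γ : 𝒯.PiX ≃ₜ* 𝒯.PiX, 𝒯.PiYdd.map γ.toMulEquiv.toMonoidHom = 𝒯.PiYdd)
    -- the coherent family, for every normalised anchor (abc-iut-f-121's p438241 output shape)
    (hfam : ∀ (α₁ : Ψ.functor.obj (T.AN 1) ≅ T.AN 1) (β₁ : Ψ.functor.obj (T.BN 1) ≅ T.BN 1) (u₁ : Aut (T.BN 1)),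
      u₁ ∈ (T.atLevel 1).units (T.BN 1) →
      α₁.inv ≫ Ψ.functor.map (T.sCap 1) ≫ β₁.hom = T.sCap 1 →
      α₁.inv ≫ Ψ.functor.map (T.sCup 1) ≫ β₁.hom = T.sCup 1 ≫ u₁.hom →
        ∀ N : ℕ+, ∃ (a : Ψ.functor.obj (T.AN N) ≅ T.AN N) (b : Ψ.functor.obj (T.BN N) ≅ T.BN N) (w : Aut (T.BN N)),
          w ∈ (T.atLevel N).units (T.BN N) ∧
          a.inv ≫ Ψ.functor.map (T.sCap N) ≫ b.hom = T.sCap N ∧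
          a.inv ≫ Ψ.functor.map (T.sCup N) ≫ b.hom = T.sCup N ≫ w.hom ∧
          a.inv ≫ Ψ.functor.map (T.α (one_dvd_level N)) ≫ α₁.hom = T.α (one_dvd_level N) ∧
          b.inv ≫ Ψ.functor.map (T.β (one_dvd_level N)) ≫ β₁.hom = T.β (one_dvd_level N))
    -- (C): the level-1 discrepancy constant of every normalised transport is a `2l`-th root of unity
    (hc : ∀ (α₁ : Ψ.functor.obj (T.AN 1) ≅ T.AN 1) (β₁ : Ψ.functor.obj (T.BN 1) ≅ T.BN 1) (u₁ : Aut (T.BN 1))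
      (hu₁ : u₁ ∈ (T.atLevel 1).units (T.BN 1)),
      α₁.inv ≫ Ψ.functor.map (T.sCap 1) ≫ β₁.hom = T.sCap 1 →
      α₁.inv ≫ Ψ.functor.map (T.sCup 1) ≫ β₁.hom = T.sCup 1 ≫ u₁.hom →
        ∀ c : T.Kˣ, (T.atLevel 1).unitsToBirat (T.BN 1) ⟨u₁, hu₁⟩ = T.constEmb 1 c → c ^ (2 * T.l) = 1) :
    T.ThetaRootPreservedAll Ψ :=
  thetaRootPreservedAll_ofConnectedTemperoidYddFamily_ofAnchored_ofPulledConstants_genuine 𝒯 ιX h Q odd_l R K' hX₀ t c₀ hc₀ ht hinvc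
    hinvp α β comm_sCap comm_sCup isIsometry_α degFr_α isIsometry_β degFr_β baseFrob_α T hT hnd
    (hgc_atLevelOne_of_constantsDictionary Cu hC hS T α₁ hD₁ hY₁) Ψ cnst G ecn hP34 hYdd αs βs hdivcap₁ hdivcup₁ hP24 hfam hc

end Dictionary

end ThetaFrobenioidTower

end Literature.AnabelianGeometry.EtaleTheta

end
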